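import Mathlib
import Summits.Ventures.PercRepro.TriangleCapVertexDeletion
import Summits.Ventures.PercRepro.TriangleCapBipartiteThree
import Summits.Ventures.PercRepro.TriangleCapDenseStabilityEight

/-!
# PercRepro — THREE BELOW THE DIAGONAL BY DELETING A PENDANT OR ISOLATED VERTEX (p3, gen 38; part 113)

A vertex `z` of degree `≤ 1` reduces the `r = 3` bound at `k` to the `r = 1` bound at `k − 1`
(`dense_stability_eight`, gen 35): with `D′ = D − z`, `Σ_D d² = Σ_{D′} d² + 2 d′(x) + 2` for a pendant `z` at `x`
(`sum_deg_sq_del`), `Σ_{D′} d² ≤ m′ k′ − (k′ − 2)` with `m′ = m − 1`, `k′ = k − 1`, and `d′(x) ≤ k − 3` (a vertex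
adjacent to all others makes `2m ≤ 3 (k − 1)`, `two_mul_card_edges_le_of_dominating`), so
`Σ_D d² ≤ mk − m ≤ mk − 3 (k − 4)` exactly when `m ≥ 3k − 12`; an isolated `z` gives `Σ_D d² ≤ m (k − 1) − (k − 3)`.
When `D′` is complete bipartite spanning, `D` itself is bipartite spanning with `|X| − 1` (pendant) resp. `|A|`
(isolated) missing cross pairs — at least three by the hypothesis on `D`, resp. by choosing the larger side —
and `bipartite_stability_three` (gen 36) applies.  **`stability_three_of_pendant`** (`K₄⁻`-free, `k ≥ 9`,
`2m ≥ 6k − 24`, not bipartite spanning with `≤ 2` missing pairs, a vertex of degree `1`) and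
**`stability_three_of_isolated`** (no bipartiteness hypothesis needed) ⇒ `Σ_v d(v)² + 3 (k − 4) ≤ m k`.
Axioms: standard.
-/

namespace PercRepro

namespace TriangleCap

namespace C047

open Finset

variable {V : Type*} [Fintype V] [DecidableEq V]

/-- A vertex adjacent to every other vertex of a `K₄⁻`-free graph forces `2m ≤ 3 (k − 1)`. -/
theorem two_mul_card_edges_le_of_dominating (D : SimpleGraph V) [DecidableRel D.Adj] (hK : K4mFree D) {x : V}
    (hx : deg D x + 1 = Fintype.card V) : 2 * D.edgeFinset.card ≤ 3 * (Fintype.card V - 1) := by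
  have hall : ∀ y, y ≠ x → D.Adj x y := by
    intro y hy
    have hsub : univ.filter (fun w => D.Adj x w) ⊆ univ.erase x := by
      intro w hw
      rw [mem_filter] at hw
      rw [mem_erase]
      exact ⟨hw.2.ne.symm, mem_univ w⟩
    have hcard : (univ.erase x).card ≤ (univ.filter (fun w => D.Adj x w)).card := by
      rw [card_erase_of_mem (mem_univ x), card_univ]
      unfold deg at hx
      omega
    have heq := eq_of_subset_of_card_le hsub hcard
    have : y ∈ univ.filter (fun w => D.Adj x w) := by rw [heq, mem_erase]; exact ⟨hy, mem_univ y⟩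
    exact (mem_filter.mp this).2
  have hdeg : ∀ y, y ≠ x → deg D y ≤ 2 := by
    intro y hy
    by_contra h
    push Not at h
    unfold deg at h
    obtain ⟨a, ha, b, hb, c, hc, hab, hac, hbc⟩ := two_lt_card.mp h
    rw [mem_filter] at ha hb hc
    have key : ∀ w₁ w₂, w₁ ≠ x → w₂ ≠ x → w₁ ≠ w₂ → D.Adj y w₁ → D.Adj y w₂ → False := by
      intro w₁ w₂ h1 h2 h12 hw1 hw2
      exact not_adj_both D hK (hall y hy) (hall w₁ h1) hw1 h12 (hall w₂ h2) hw2
    by_cases hax : a = x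
    · subst hax
      exact key b c (Ne.symm hab) (Ne.symm hac) hbc hb.2 hc.2
    · by_cases hbx : b = x
      · subst hbx
        exact key a c hax (Ne.symm hbc) hac ha.2 hc.2
      · exact key a b hax hbx hab ha.2 hb.2
  have hsum := sum_deg_eq D
  rw [← add_sum_erase univ (deg D) (mem_univ x)] at hsum
  have hle : ∑ y ∈ univ.erase x, deg D y ≤ ∑ _y ∈ univ.erase x, 2 :=
    sum_le_sum (fun y hy => hdeg y (mem_erase.mp hy).1)
  rw [sum_const, card_erase_of_mem (mem_univ x), card_univ, smul_eq_mul] at hle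
  omega

omit [Fintype V] [DecidableEq V] in
/-- Membership in the image of a Finset of `{v // v ≠ z}` in `V`. -/
theorem mem_map_subtype (z : V) (A : Finset {v : V // v ≠ z}) (u : V) :
    u ∈ A.map (Function.Embedding.subtype (fun v => v ≠ z)) ↔ ∃ h : u ≠ z, ⟨u, h⟩ ∈ A := by
  rw [mem_map]
  constructor
  · rintro ⟨a, ha, rfl⟩
    exact ⟨a.2, ha⟩
  · rintro ⟨h, ha⟩
    exact ⟨⟨u, h⟩, ha, rfl⟩

omit [Fintype V] [DecidableEq V] in
/-- A complete bipartition of `D − z` transfers to `D` off `z`. -/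
theorem bip_of_del (D : SimpleGraph V) [DecidableRel D.Adj] (z : V) (A : Finset {v : V // v ≠ z})
    (hA : ∀ a b, (del D z).Adj a b ↔ Xor (a ∈ A) (b ∈ A)) (X : Finset V)
    (hmemX : ∀ u, u ∈ X ↔ ∃ h : u ≠ z, ⟨u, h⟩ ∈ A) {u v : V} (hu : u ≠ z) (hv : v ≠ z) (huv : D.Adj u v) :
    (u ∈ X ↔ v ∉ X) := by
  have h := (hA ⟨u, hu⟩ ⟨v, hv⟩).mp huv
  rw [hmemX, hmemX]
  constructor
  · intro hu' hv'
    obtain ⟨hu1, hu2⟩ := hu'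
    obtain ⟨hv1, hv2⟩ := hv'
    rcases h with ⟨-, h2⟩ | ⟨-, h2⟩
    · exact h2 hv2
    · exact h2 hu2
  · intro hvn
    refine ⟨hu, ?_⟩
    rcases h with ⟨h1, -⟩ | ⟨h1, h2⟩
    · exact h1
    · exact absurd ⟨hv, h1⟩ hvn

/-- The complement of a complete bipartition is one. -/
theorem bip_compl (D : SimpleGraph V) [DecidableRel D.Adj] (z : V) (A : Finset {v : V // v ≠ z})
    (hA : ∀ a b, (del D z).Adj a b ↔ Xor (a ∈ A) (b ∈ A)) :
    ∀ a b, (del D z).Adj a b ↔ Xor (a ∈ Aᶜ) (b ∈ Aᶜ) := by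
  intro a b
  rw [hA a b, mem_compl, mem_compl]
  exact xor_not_not.symm

/-- **THE PENDANT REDUCTION:** `K₄⁻`-free, `k ≥ 9`, `2m ≥ 6k − 24`, not bipartite spanning with `≤ 2` missing pairs,
a vertex of degree `1` ⇒ `Σ_v d(v)² + 3 (k − 4) ≤ m k`. -/
theorem stability_three_of_pendant (D : SimpleGraph V) [DecidableRel D.Adj] (hK : K4mFree D)
    (hk : 9 ≤ Fintype.card V) (hm : 6 * Fintype.card V ≤ 2 * D.edgeFinset.card + 24)
    (hnot : ¬ ∃ A : Finset V, (∀ x y, D.Adj x y → (x ∈ A ↔ y ∉ A)) ∧ (missing D A Aᶜ).card ≤ 2)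
    {z : V} (hz : deg D z = 1) :
    ∑ v, deg D v * deg D v + 3 * (Fintype.card V - 4) ≤ D.edgeFinset.card * Fintype.card V := by
  have hz' := hz
  unfold deg at hz'
  obtain ⟨x, hx⟩ := card_eq_one.mp hz'
  have hzx : D.Adj z x := by
    have : x ∈ univ.filter (fun w => D.Adj z w) := by rw [hx]; exact mem_singleton_self x
    exact (mem_filter.mp this).2
  have hnb : ∀ w, D.Adj z w → w = x := by
    intro w hw
    have : w ∈ univ.filter (fun w => D.Adj z w) := mem_filter.mpr ⟨mem_univ w, hw⟩
    rw [hx, mem_singleton] at this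
    exact this
  have hxz : x ≠ z := hzx.ne.symm
  have hcard := card_del z
  have hedges := card_edges_del D z
  rw [hz] at hedges
  have hsq := sum_deg_sq_del D z
  rw [hz] at hsq
  have hsum1 : ∑ a : {v : V // v ≠ z}, (if D.Adj a.1 z then deg (del D z) a else 0) =
      deg (del D z) ⟨x, hxz⟩ := by
    rw [sum_eq_single ⟨x, hxz⟩]
    · simp only [D.adj_symm hzx, if_true]
    · intro a _ ha
      have : ¬ D.Adj a.1 z := fun h => ha (Subtype.ext (hnb a.1 (D.adj_symm h)))
      simp only [this, if_false]
    · intro h; exact absurd (mem_univ _) h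
  rw [hsum1] at hsq
  have hdx := deg_del D z ⟨x, hxz⟩
  simp only [D.adj_symm hzx, if_true] at hdx
  -- `x` is not dominating
  have hxdom : deg D x + 2 ≤ Fintype.card V := by
    by_contra h
    push Not at h
    have hle : deg D x ≤ Fintype.card V - 1 := by
      unfold deg
      have hsub : univ.filter (fun w => D.Adj x w) ⊆ univ.erase x := by
        intro w hw
        rw [mem_filter] at hw
        rw [mem_erase]
        exact ⟨hw.2.ne.symm, mem_univ w⟩
      have := card_le_card hsub
      rw [card_erase_of_mem (mem_univ x), card_univ] at this
      exact this
    have hxd : deg D x + 1 = Fintype.card V := by omega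
    have := two_mul_card_edges_le_of_dominating D hK hxd
    omega
  by_cases hbip : ∃ A : Finset {v : V // v ≠ z}, ∀ a b, (del D z).Adj a b ↔ Xor (a ∈ A) (b ∈ A)
  · obtain ⟨A₀, hA₀⟩ := hbip
    have hA : ∃ A : Finset {v : V // v ≠ z}, ⟨x, hxz⟩ ∈ A ∧
        ∀ a b, (del D z).Adj a b ↔ Xor (a ∈ A) (b ∈ A) := by
      by_cases hxA : (⟨x, hxz⟩ : {v : V // v ≠ z}) ∈ A₀
      · exact ⟨A₀, hxA, hA₀⟩
      · exact ⟨A₀ᶜ, mem_compl.mpr hxA, bip_compl D z A₀ hA₀⟩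
    obtain ⟨A, hxA, hA⟩ := hA
    obtain ⟨X, hX⟩ : ∃ X : Finset V, X = A.map (Function.Embedding.subtype (fun v => v ≠ z)) := ⟨_, rfl⟩
    have hmemX : ∀ u, u ∈ X ↔ ∃ h : u ≠ z, ⟨u, h⟩ ∈ A := fun u => by rw [hX]; exact mem_map_subtype z A u
    have hxX : x ∈ X := (hmemX x).mpr ⟨hxz, hxA⟩
    have hzX : z ∉ X := fun h => by obtain ⟨h', -⟩ := (hmemX z).mp h; exact h' rfl
    have hbipD : ∀ u v, D.Adj u v → (u ∈ X ↔ v ∉ X) := by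
      intro u v huv
      by_cases hu : u = z
      · subst hu
        have := hnb v huv
        subst this
        simp only [hzX, hxX, not_true_eq_false]
      · by_cases hv : v = z
        · subst hv
          have := hnb u (D.adj_symm huv)
          subst this
          simp only [hzX, hxX, not_false_eq_true]
        · exact bip_of_del D z A hA X hmemX hu hv huv
    have hmiss : missing D X Xᶜ = (X.erase x).map ⟨fun u => (u, z), fun _ _ h => (Prod.mk.inj h).1⟩ := by
      ext p
      unfold missing
      rw [mem_filter, mem_product, mem_compl, mem_map]
      constructor
      · rintro ⟨⟨hp1, hp2⟩, hnadj⟩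
        have hp2z : p.2 = z := by
          by_contra hne
          obtain ⟨h1, hp1'⟩ := (hmemX p.1).mp hp1
          have hp2' : (⟨p.2, hne⟩ : {v : V // v ≠ z}) ∉ A := fun h' => hp2 ((hmemX p.2).mpr ⟨hne, h'⟩)
          exact hnadj ((hA ⟨p.1, h1⟩ ⟨p.2, hne⟩).mpr (Or.inl ⟨hp1', hp2'⟩))
        refine ⟨p.1, ?_, ?_⟩
        · rw [mem_erase]
          refine ⟨?_, hp1⟩
          intro hpx
          apply hnadj
          rw [hpx, hp2z]
          exact D.adj_symm hzx
        · simp only [Function.Embedding.coeFn_mk]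
          exact Prod.ext rfl hp2z.symm
      · rintro ⟨u, hu, rfl⟩
        rw [mem_erase] at hu
        simp only [Function.Embedding.coeFn_mk]
        refine ⟨⟨hu.2, hzX⟩, ?_⟩
        intro h
        exact hu.1 (hnb u (D.adj_symm h))
    have hmisscard : (missing D X Xᶜ).card + 1 = X.card := by
      rw [hmiss, card_map, card_erase_of_mem hxX]
      have : 1 ≤ X.card := card_pos.mpr ⟨x, hxX⟩
      omega
    have hN : 3 ≤ (missing D X Xᶜ).card := by
      by_contra h
      exact hnot ⟨X, hbipD, by omega⟩
    exact bipartite_stability_three D X hbipD hN (by omega)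
  · have h1 := dense_stability_eight (del D z) (k4mFree_del D hK z) (by omega) (by omega) hbip
    obtain ⟨k', hk'⟩ : ∃ k', Fintype.card {v : V // v ≠ z} = k' := ⟨_, rfl⟩
    obtain ⟨m', hm'⟩ : ∃ m', (del D z).edgeFinset.card = m' := ⟨_, rfl⟩
    obtain ⟨d', hd'⟩ : ∃ d', deg (del D z) ⟨x, hxz⟩ = d' := ⟨_, rfl⟩
    rw [hk', hm'] at h1
    rw [hk'] at hcard
    rw [hm'] at hedges
    rw [hd'] at hsq hdx
    have hkV : Fintype.card V = k' + 1 := by omega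
    have hmD : D.edgeFinset.card = m' + 1 := by omega
    rw [hkV, hmD, hsq]
    have e1 : k' + 1 - 4 = k' - 3 := by omega
    have e2 : k' - 2 = k' - 3 + 1 := by omega
    rw [e1]
    rw [e2] at h1
    have hd : d' + 1 ≤ k' - 1 := by omega
    have hk3 : 3 ≤ k' := by omega
    obtain ⟨k'', hk''⟩ : ∃ k'', k' = k'' + 3 := ⟨k' - 3, by omega⟩
    subst hk''
    have e3 : k'' + 3 - 3 = k'' := by omega
    have e4 : k'' + 3 - 1 = k'' + 2 := by omega
    rw [e3] at h1 ⊢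
    rw [e4] at hd
    nlinarith

/-- **THE ISOLATED-VERTEX REDUCTION:** `K₄⁻`-free, `k ≥ 9`, `2m ≥ 6k − 24`, an isolated vertex ⇒
`Σ_v d(v)² + 3 (k − 4) ≤ m k` (no bipartiteness hypothesis is needed: a complete bipartite `D − z` gives `D` at least
three missing pairs on the larger side). -/
theorem stability_three_of_isolated (D : SimpleGraph V) [DecidableRel D.Adj] (hK : K4mFree D)
    (hk : 9 ≤ Fintype.card V) (hm : 6 * Fintype.card V ≤ 2 * D.edgeFinset.card + 24)
    {z : V} (hz : deg D z = 0) :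
    ∑ v, deg D v * deg D v + 3 * (Fintype.card V - 4) ≤ D.edgeFinset.card * Fintype.card V := by
  have hnb : ∀ w, ¬ D.Adj z w := by
    intro w hw
    unfold deg at hz
    rw [card_eq_zero, filter_eq_empty_iff] at hz
    exact hz (mem_univ w) hw
  have hcard := card_del z
  have hedges := card_edges_del D z
  rw [hz, add_zero] at hedges
  have hsq := sum_deg_sq_del D z
  rw [hz] at hsq
  have hsum1 : ∑ a : {v : V // v ≠ z}, (if D.Adj a.1 z then deg (del D z) a else 0) = 0 := by
    apply sum_eq_zero
    intro a _
    have : ¬ D.Adj a.1 z := fun h => hnb a.1 (D.adj_symm h)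
    simp only [this, if_false]
  rw [hsum1] at hsq
  by_cases hbip : ∃ A : Finset {v : V // v ≠ z}, ∀ a b, (del D z).Adj a b ↔ Xor (a ∈ A) (b ∈ A)
  · obtain ⟨A₀, hA₀⟩ := hbip
    have hA : ∃ A : Finset {v : V // v ≠ z}, 3 ≤ A.card ∧ ∀ a b, (del D z).Adj a b ↔ Xor (a ∈ A) (b ∈ A) := by
      by_cases h3 : 3 ≤ A₀.card
      · exact ⟨A₀, h3, hA₀⟩
      · refine ⟨A₀ᶜ, ?_, bip_compl D z A₀ hA₀⟩
        rw [card_compl]; omega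
    obtain ⟨A, hA3, hA⟩ := hA
    obtain ⟨X, hX⟩ : ∃ X : Finset V, X = A.map (Function.Embedding.subtype (fun v => v ≠ z)) := ⟨_, rfl⟩
    have hmemX : ∀ u, u ∈ X ↔ ∃ h : u ≠ z, ⟨u, h⟩ ∈ A := fun u => by rw [hX]; exact mem_map_subtype z A u
    have hzX : z ∉ X := fun h => by obtain ⟨h', -⟩ := (hmemX z).mp h; exact h' rfl
    have hbipD : ∀ u v, D.Adj u v → (u ∈ X ↔ v ∉ X) := by
      intro u v huv
      by_cases hu : u = z
      · subst hu; exact absurd huv (hnb v)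
      · by_cases hv : v = z
        · subst hv; exact absurd (D.adj_symm huv) (hnb u)
        · exact bip_of_del D z A hA X hmemX hu hv huv
    have hmiss : X.map ⟨fun u => (u, z), fun _ _ h => (Prod.mk.inj h).1⟩ ⊆ missing D X Xᶜ := by
      intro p hp
      rw [mem_map] at hp
      obtain ⟨u, hu, rfl⟩ := hp
      unfold missing
      rw [mem_filter, mem_product, mem_compl]
      simp only [Function.Embedding.coeFn_mk]
      exact ⟨⟨hu, hzX⟩, fun h => hnb u (D.adj_symm h)⟩
    have hN : 3 ≤ (missing D X Xᶜ).card := by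
      have := card_le_card hmiss
      rw [card_map] at this
      have hXc : X.card = A.card := by rw [hX, card_map]
      omega
    exact bipartite_stability_three D X hbipD hN (by omega)
  · have h1 := dense_stability_eight (del D z) (k4mFree_del D hK z) (by omega) (by omega) hbip
    obtain ⟨k', hk'⟩ : ∃ k', Fintype.card {v : V // v ≠ z} = k' := ⟨_, rfl⟩
    rw [hk'] at h1
    rw [hk'] at hcard
    have hkV : Fintype.card V = k' + 1 := by omega
    rw [hkV, hsq, ← hedges]
    have e1 : k' + 1 - 4 = k' - 3 := by omega
    rw [e1]
    obtain ⟨k'', hk''⟩ : ∃ k'', k' = k'' + 3 := ⟨k' - 3, by omega⟩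
    subst hk''
    have e3 : k'' + 3 - 3 = k'' := by omega
    have e4 : k'' + 3 - 2 = k'' + 1 := by omega
    rw [e3]
    rw [e4] at h1
    nlinarith

end C047

end TriangleCap

end PercRepro
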